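import Mathlib
import Summits.ValiantsHypothesis.ValiantsHypothesis.Theorems.TwoProducts.Negative.CommonPadding
import Summits.ValiantsHypothesis.ValiantsHypothesis.Theorems.TwoProducts.Negative.RankTwoPaddingResidual
import Summits.ValiantsHypothesis.ValiantsHypothesis.Theorems.TwoProducts.Negative.FullPadding
import Summits.ValiantsHypothesis.ValiantsHypothesis.Theorems.TwoProducts.Negative.FullPaddingThresholds
import HarnessLib

/-!
# NEGATIVE lane (val-neg-1 g5): the residual LAW of the relation ladder IS `PlanarCellBound`

Helper file for crux `stmt-ValiantsHypothesis-5906` (filed `--supports`; closes NO item, proves NO summit statement, does NOT prove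
`TwoProducts`, `PlanarCellBound`, any `ResidualLawV…` or VP ≠ VNP; 0 `def`s).  Sequel to `Negative/FullPadding.lean`,
`Negative/FullPaddingThresholds.lean`, `Negative/RankTwoPaddingResidual.lean` (same seat).

MAIN THEOREM `planarCellBound_of_residualV12`: the text of `ResidualLawV12` (workfile `Cruxes/TwoProducts/Lines/relation_ladder.lean`, its
Cruxes-side `ClassCover` unfolded verbatim) IMPLIES the text of `PlanarCellBound` (verbatim the hypothesis `hP` of the landed
`twoProducts_of_planarCellBound`, = `Cruxes/TwoProducts/Lines/planar_cell.lean :: PlanarCellBound`) with `(a, b) ↦ (9a, b + 64a)`.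
Mechanism: pad `(u, v)` by `g = 4k`, `k = m + 4 (log₂(t+2) + 1)` gadget pairs `X^{c_i s} + X^{2 c_i s}`, `c_i = 2·5^i`, common to both sides;
then `2^{m+2g} (t+2)^4 < 5^g`, so (R5) and (R1_r) hold for the padded instance OUTRIGHT (`FullPaddingThresholds`), the cells of `(u, v)` are cells
of the padded pair (`FullPadding`), and the padded size `m + 2g = 9m + 32(log₂(t+2)+1)` costs `2^{a(m+2g)} ≤ 2^{9am} (t+2)^{64a}`.

COROLLARIES (`Iff`s, all as `∃ a b` laws): `ResidualLawV12 ⇔ PlanarCellBound`, `ResidualLawV20 ⇔ PlanarCellBound`, and the v21 CANDIDATE's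
residual `(R5) ∧ (R1_r) ∧ ¬HasDatum ⇒ cells small` `⇔ PlanarCellBound`.  READING (numbers, not adjectives): the rungs (R5), (R1_r) and every
datum hatch of v14…v21 excise NO asymptotic content — the line's residual stub is, up to `(a, b) ↦ (9a, b + 66a)`, the statement `PlanarCellBound`
that the line set out to reduce.  Nothing here bears on the truth of `PlanarCellBound` / 5906.  [folklore]
-/

namespace Summit.ValiantsHypothesis.Theorems.TwoProducts.Negative.FullPaddingResidual

open Finset MvPolynomial
open Summit.ValiantsHypothesis.ValiantsHypothesis.Theorems.NewtonUnitEquations.TwoProducts.FormalLogLinearisation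
open Summit.ValiantsHypothesis.ValiantsHypothesis.Theorems.NewtonUnitEquations.TwoProducts.PlanarCell
open Summit.ValiantsHypothesis.ValiantsHypothesis.Theorems.NewtonUnitEquations.TwoProducts.PermutationType
  (msetT PermType RankOneCoincidences)
open Summit.ValiantsHypothesis.Theorems.TwoProducts.Negative.CommonPadding
open Summit.ValiantsHypothesis.Theorems.TwoProducts.Negative.FullPadding
open Summit.ValiantsHypothesis.Theorems.TwoProducts.Negative.FullPaddingThresholds
open Summit.ValiantsHypothesis.Theorems.TwoProducts.Negative.RankTwoPaddingResidual
  (residualV20_iff_residualV12 residualNoDatum_iff_residualV12)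

variable {m : ℕ}

/-! ### Arithmetic of the padding size `g = 4k`, `k = m + 4(L+1)`, `2^L ≤ t+2 < 2^{L+1}` -/

/-- The numeric condition `2^{m+2g} (t+2)^4 < 5^g`. [folklore] -/
theorem fullPadding_condition {m t L k : ℕ} (hL : t + 2 < 2 ^ (L + 1)) (hk : k = m + 4 * (L + 1)) :
    2 ^ (m + (4 * k + 4 * k)) * (t + 2) ^ 4 < 5 ^ (4 * k) := by
  have h2 : 2 ^ m * (2 ^ (L + 1)) ^ 4 = 2 ^ k := by
    rw [← pow_mul, ← pow_add, hk]; ring_nf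
  have h3 : 2 ^ (m + (4 * k + 4 * k)) = 2 ^ m * 256 ^ k := by
    rw [pow_add, show 4 * k + 4 * k = 8 * k by ring, pow_mul]; norm_num
  have h4 : 5 ^ (4 * k) = 625 ^ k := by rw [pow_mul]; norm_num
  have h5 : 2 ^ k * 256 ^ k = 512 ^ k := by rw [← mul_pow]; norm_num
  have h6 : 512 ^ k ≤ 625 ^ k := Nat.pow_le_pow_left (by norm_num) k
  calc 2 ^ (m + (4 * k + 4 * k)) * (t + 2) ^ 4 = 2 ^ m * (t + 2) ^ 4 * 256 ^ k := by rw [h3]; ring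
    _ < 2 ^ m * (2 ^ (L + 1)) ^ 4 * 256 ^ k := by gcongr
    _ = 2 ^ k * 256 ^ k := by rw [h2]
    _ = 512 ^ k := h5
    _ ≤ 625 ^ k := h6
    _ = 5 ^ (4 * k) := h4.symm

/-- The cost of the padding: `2^{a(m+2g)} (t+2)^b ≤ 2^{9am} (t+2)^{b+64a}`. [folklore] -/
theorem fullPadding_cost {m t L k : ℕ} (a b : ℕ) (hL : 2 ^ L ≤ t + 2) (hk : k = m + 4 * (L + 1)) :
    2 ^ (a * (m + (4 * k + 4 * k))) * (t + 2) ^ b ≤ 2 ^ ((9 * a) * m) * (t + 2) ^ (b + 64 * a) := by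
  have e1 : a * (m + (4 * k + 4 * k)) = (9 * a) * m + (32 * a) * (L + 1) := by rw [hk]; ring
  have hL1 : 2 ^ (L + 1) ≤ (t + 2) ^ 2 := by
    calc 2 ^ (L + 1) = 2 ^ L * 2 := pow_succ _ _
      _ ≤ (t + 2) * (t + 2) := Nat.mul_le_mul hL (by omega)
      _ = (t + 2) ^ 2 := (sq _).symm
  have e2 : 2 ^ ((32 * a) * (L + 1)) ≤ (t + 2) ^ (64 * a) := by
    calc 2 ^ ((32 * a) * (L + 1)) = (2 ^ (L + 1)) ^ (32 * a) := by rw [mul_comm, pow_mul]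
      _ ≤ ((t + 2) ^ 2) ^ (32 * a) := Nat.pow_le_pow_left hL1 _
      _ = (t + 2) ^ (64 * a) := by rw [← pow_mul]; ring_nf
  calc 2 ^ (a * (m + (4 * k + 4 * k))) * (t + 2) ^ b
      = 2 ^ ((9 * a) * m) * 2 ^ ((32 * a) * (L + 1)) * (t + 2) ^ b := by rw [e1, pow_add]
    _ ≤ 2 ^ ((9 * a) * m) * (t + 2) ^ (64 * a) * (t + 2) ^ b := Nat.mul_le_mul_right _ (Nat.mul_le_mul_left _ e2)
    _ = 2 ^ ((9 * a) * m) * (t + 2) ^ (b + 64 * a) := by rw [pow_add]; ring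

/-! ### `ResidualLawV12 ⇒ PlanarCellBound` -/

/-- **The v12 residual implies `PlanarCellBound`** (texts verbatim; `(a, b) ↦ (9a, b + 64a)`). [folklore] -/
theorem planarCellBound_of_residualV12
    (h : ∃ a b : ℕ, ∀ (m t : ℕ), 2 ≤ t → ∀ (u v : Fin m → MvPolynomial (Fin 2) ℂ),
      (∀ j, coeff 0 (u j) = 0 ∧ (u j).support.card ≤ t) → (∀ j, coeff 0 (v j) = 0 ∧ (v j).support.card ≤ t) →
      (∀ (J : Finset (Fin m)) (j₀ : Fin m), j₀ ∈ J →
        BlockSmall (fun j => (u j).support ∪ (v j).support) J (2 ^ m * (t + 2) ^ 4) →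
        ¬ PermType (mergeA (fun j => (u j).support ∪ (v j).support) J j₀)) →
      (∀ (r : ℕ) (Jc : Fin r → Finset (Fin m)) (ac bc : Fin r → Fin m → Expo),
        (∀ a ∈ tuples (fun j => (u j).support ∪ (v j).support), ∀ b ∈ tuples (fun j => (u j).support ∪ (v j).support),
          a ≠ b → ∑ j, a j = ∑ j, b j →
          ∃ k : Fin r, (∀ j, a j ≠ b j ↔ j ∈ Jc k) ∧
            ((∀ j ∈ Jc k, a j = ac k j ∧ b j = bc k j) ∨ (∀ j ∈ Jc k, a j = bc k j ∧ b j = ac k j))) →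
        2 ^ m * (t + 2) ^ 4 < 2 * (m + 1) * (3 * (2 + m + m.choose 2) ^ 2) ^ r) →
      ∀ (R : Expo → Expo → Prop) (S : Finset Expo), IsCellFamily u v R S → S.card ≤ 2 ^ (a * m) * (t + 2) ^ b) :
    ∃ a b : ℕ, ∀ (m t : ℕ), 2 ≤ t → ∀ (u v : Fin m → MvPolynomial (Fin 2) ℂ),
      (∀ j, coeff 0 (u j) = 0 ∧ (u j).support.card ≤ t) → (∀ j, coeff 0 (v j) = 0 ∧ (v j).support.card ≤ t) →
      ∀ (R : Expo → Expo → Prop) (S : Finset Expo),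
        (∀ l ∈ S, ∃ ξ : Fin 2 → ℝ, ValidWeight u v ξ ∧ IsStrictTop ξ (logSupport u v) l ∧
          ∀ e ∈ ((Finset.univ.biUnion fun j => (u j).support) ∪ Finset.univ.biUnion fun j => (v j).support),
          ∀ e' ∈ ((Finset.univ.biUnion fun j => (u j).support) ∪ Finset.univ.biUnion fun j => (v j).support),
            (R e e' ↔ wt ξ e ≤ wt ξ e')) →
        S.card ≤ 2 ^ (a * m) * (t + 2) ^ b := by
  obtain ⟨a, b, h⟩ := h
  refine ⟨9 * a, b + 64 * a, fun m t ht u v hu hv R S hS => ?_⟩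
  change IsCellFamily u v R S at hS
  rcases S.eq_empty_or_nonempty with rfl | hne
  · simp
  have hT := tailSupport_nonempty_of_isCellFamily hS hne
  have hs0 := tailSum_ne_zero (fun j => (hu j).1) (fun j => (hv j).1) hT
  obtain ⟨L, hLdef⟩ : ∃ L, L = Nat.log 2 (t + 2) := ⟨_, rfl⟩
  obtain ⟨k, hk⟩ : ∃ k, k = m + 4 * (L + 1) := ⟨_, rfl⟩
  have hlt : t + 2 < 2 ^ (L + 1) := by rw [hLdef]; exact Nat.lt_pow_succ_log_self (by norm_num) _
  have hle : 2 ^ L ≤ t + 2 := by rw [hLdef]; exact Nat.pow_log_le_self 2 (by omega)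
  have hC := fullPadding_condition hlt hk
  obtain ⟨hu', hv', -, -, -, hcell⟩ := fullPadding_spec (g := 4 * k) ht u v hu hv hT _ rfl
  obtain ⟨R', hS'⟩ := hcell R S hS
  exact (h (m + (4 * k + 4 * k)) t ht _ _ hu' hv'
    (fullPadding_noSmallPermMerge (t := t) _ hs0 (fullPadding_letters (m := m) (g := 4 * k) u v hs0 _ rfl) hC)
    (fullPadding_noCheapCover (t := t) _ hs0 (fullPadding_letters (m := m) (g := 4 * k) u v hs0 _ rfl) hC)
    R' S hS').trans (fullPadding_cost a b hle hk)

/-- **`ResidualLawV12 ⇔ PlanarCellBound`** as `∃ a b` laws. [folklore] -/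
theorem residualV12_iff_planarCellBound :
    (∃ a b : ℕ, ∀ (m t : ℕ), 2 ≤ t → ∀ (u v : Fin m → MvPolynomial (Fin 2) ℂ),
      (∀ j, coeff 0 (u j) = 0 ∧ (u j).support.card ≤ t) → (∀ j, coeff 0 (v j) = 0 ∧ (v j).support.card ≤ t) →
      (∀ (J : Finset (Fin m)) (j₀ : Fin m), j₀ ∈ J →
        BlockSmall (fun j => (u j).support ∪ (v j).support) J (2 ^ m * (t + 2) ^ 4) →
        ¬ PermType (mergeA (fun j => (u j).support ∪ (v j).support) J j₀)) →
      (∀ (r : ℕ) (Jc : Fin r → Finset (Fin m)) (ac bc : Fin r → Fin m → Expo),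
        (∀ a ∈ tuples (fun j => (u j).support ∪ (v j).support), ∀ b ∈ tuples (fun j => (u j).support ∪ (v j).support),
          a ≠ b → ∑ j, a j = ∑ j, b j →
          ∃ k : Fin r, (∀ j, a j ≠ b j ↔ j ∈ Jc k) ∧
            ((∀ j ∈ Jc k, a j = ac k j ∧ b j = bc k j) ∨ (∀ j ∈ Jc k, a j = bc k j ∧ b j = ac k j))) →
        2 ^ m * (t + 2) ^ 4 < 2 * (m + 1) * (3 * (2 + m + m.choose 2) ^ 2) ^ r) →
      ∀ (R : Expo → Expo → Prop) (S : Finset Expo), IsCellFamily u v R S → S.card ≤ 2 ^ (a * m) * (t + 2) ^ b) ↔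
    (∃ a b : ℕ, ∀ (m t : ℕ), 2 ≤ t → ∀ (u v : Fin m → MvPolynomial (Fin 2) ℂ),
      (∀ j, coeff 0 (u j) = 0 ∧ (u j).support.card ≤ t) → (∀ j, coeff 0 (v j) = 0 ∧ (v j).support.card ≤ t) →
      ∀ (R : Expo → Expo → Prop) (S : Finset Expo),
        (∀ l ∈ S, ∃ ξ : Fin 2 → ℝ, ValidWeight u v ξ ∧ IsStrictTop ξ (logSupport u v) l ∧
          ∀ e ∈ ((Finset.univ.biUnion fun j => (u j).support) ∪ Finset.univ.biUnion fun j => (v j).support),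
          ∀ e' ∈ ((Finset.univ.biUnion fun j => (u j).support) ∪ Finset.univ.biUnion fun j => (v j).support),
            (R e e' ↔ wt ξ e ≤ wt ξ e')) →
        S.card ≤ 2 ^ (a * m) * (t + 2) ^ b) :=
  ⟨planarCellBound_of_residualV12, fun ⟨a, b, h⟩ =>
    ⟨a, b, fun m t ht u v hu hv _ _ R S hS => h m t ht u v hu hv R S hS⟩⟩

/-- **`ResidualLawV20 ⇔ PlanarCellBound`** as `∃ a b` laws (v20 = the registered skeleton's residual; its seven datum hatches and the
Cruxes-side `ClassCover` unfolded verbatim). [folklore] -/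
theorem residualV20_iff_planarCellBound :
    (∃ a b : ℕ, ∀ (m t : ℕ), 2 ≤ t → ∀ (u v : Fin m → MvPolynomial (Fin 2) ℂ),
      (∀ j, coeff 0 (u j) = 0 ∧ (u j).support.card ≤ t) → (∀ j, coeff 0 (v j) = 0 ∧ (v j).support.card ≤ t) →
      (∀ (J : Finset (Fin m)) (j₀ : Fin m), j₀ ∈ J →
        BlockSmall (fun j => (u j).support ∪ (v j).support) J (2 ^ m * (t + 2) ^ 4) →
        ¬ PermType (mergeA (fun j => (u j).support ∪ (v j).support) J j₀)) →
      (∀ (r : ℕ) (Jc : Fin r → Finset (Fin m)) (ac bc : Fin r → Fin m → Expo),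
        (∀ a ∈ tuples (fun j => (u j).support ∪ (v j).support), ∀ b ∈ tuples (fun j => (u j).support ∪ (v j).support),
          a ≠ b → ∑ j, a j = ∑ j, b j →
          ∃ k : Fin r, (∀ j, a j ≠ b j ↔ j ∈ Jc k) ∧
            ((∀ j ∈ Jc k, a j = ac k j ∧ b j = bc k j) ∨ (∀ j ∈ Jc k, a j = bc k j ∧ b j = ac k j))) →
        2 ^ m * (t + 2) ^ 4 < 2 * (m + 1) * (3 * (2 + m + m.choose 2) ^ 2) ^ r) →
      (¬ ∃ α β γ δ : Expo, α ≠ β ∧ α ≠ γ ∧ α ≠ δ ∧ β ≠ γ ∧ β ≠ δ ∧ γ ≠ δ ∧ α + β = γ + δ ∧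
        RankOneCoincidences (fun j => (u j).support ∪ (v j).support)
          (Finsupp.single γ 1 + Finsupp.single δ 1) (Finsupp.single α 1 + Finsupp.single β 1)) →
      (¬ ∃ α β γ : Expo, α ≠ β ∧ α ≠ γ ∧ β ≠ γ ∧ α = β + γ ∧
        RankOneCoincidences (fun j => (u j).support ∪ (v j).support)
          (Finsupp.single β 1 + Finsupp.single γ 1) (Finsupp.single α 1)) →
      (¬ ∃ α β γ : Expo, α ≠ β ∧ α ≠ γ ∧ β ≠ γ ∧ α + γ = β + β ∧
        RankOneCoincidences (fun j => (u j).support ∪ (v j).support)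
          (Finsupp.single β 2) (Finsupp.single α 1 + Finsupp.single γ 1)) →
      (¬ ∃ (α β γ : Expo) (q r : ℕ), 1 ≤ q ∧ 1 ≤ r ∧ α ≠ β ∧ α ≠ γ ∧ β ≠ γ ∧ α = q • β + r • γ ∧
        RankOneCoincidences (fun j => (u j).support ∪ (v j).support)
          (Finsupp.single β q + Finsupp.single γ r) (Finsupp.single α 1)) →
      (¬ ∃ α β γ : Expo, ∃ q r : ℕ, α ≠ β ∧ α ≠ γ ∧ β ≠ γ ∧ 1 ≤ q ∧ 1 ≤ r ∧ q • α + r • γ = (q + r) • β ∧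
        RankOneCoincidences (fun j => (u j).support ∪ (v j).support)
          (Finsupp.single β (q + r)) (Finsupp.single α q + Finsupp.single γ r)) →
      (¬ ∃ (α β γ : Expo) (p q r : ℕ), 1 ≤ p ∧ 1 ≤ q ∧ 1 ≤ r ∧ α ≠ β ∧ α ≠ γ ∧ β ≠ γ ∧ p • α = q • β + r • γ ∧
        RankOneCoincidences (fun j => (u j).support ∪ (v j).support)
          (Finsupp.single β q + Finsupp.single γ r) (Finsupp.single α p)) →
      (¬ ∃ (α β : Expo) (p q : ℕ), 1 ≤ p ∧ 1 ≤ q ∧ α ≠ β ∧ p • α = q • β ∧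
        RankOneCoincidences (fun j => (u j).support ∪ (v j).support) (Finsupp.single β q) (Finsupp.single α p)) →
      ∀ (R : Expo → Expo → Prop) (S : Finset Expo), IsCellFamily u v R S → S.card ≤ 2 ^ (a * m) * (t + 2) ^ b) ↔
    (∃ a b : ℕ, ∀ (m t : ℕ), 2 ≤ t → ∀ (u v : Fin m → MvPolynomial (Fin 2) ℂ),
      (∀ j, coeff 0 (u j) = 0 ∧ (u j).support.card ≤ t) → (∀ j, coeff 0 (v j) = 0 ∧ (v j).support.card ≤ t) →
      ∀ (R : Expo → Expo → Prop) (S : Finset Expo),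
        (∀ l ∈ S, ∃ ξ : Fin 2 → ℝ, ValidWeight u v ξ ∧ IsStrictTop ξ (logSupport u v) l ∧
          ∀ e ∈ ((Finset.univ.biUnion fun j => (u j).support) ∪ Finset.univ.biUnion fun j => (v j).support),
          ∀ e' ∈ ((Finset.univ.biUnion fun j => (u j).support) ∪ Finset.univ.biUnion fun j => (v j).support),
            (R e e' ↔ wt ξ e ≤ wt ξ e')) →
        S.card ≤ 2 ^ (a * m) * (t + 2) ^ b) :=
  residualV20_iff_residualV12.trans residualV12_iff_planarCellBound

/-- **The v21 CANDIDATE's residual `⇔ PlanarCellBound`** as `∃ a b` laws ((R5) ∧ (R1_r) ∧ `¬ HasDatum`, `HasDatum` unfolded). [folklore] -/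
theorem residualNoDatum_iff_planarCellBound :
    (∃ a b : ℕ, ∀ (m t : ℕ), 2 ≤ t → ∀ (u v : Fin m → MvPolynomial (Fin 2) ℂ),
      (∀ j, coeff 0 (u j) = 0 ∧ (u j).support.card ≤ t) → (∀ j, coeff 0 (v j) = 0 ∧ (v j).support.card ≤ t) →
      (∀ (J : Finset (Fin m)) (j₀ : Fin m), j₀ ∈ J →
        BlockSmall (fun j => (u j).support ∪ (v j).support) J (2 ^ m * (t + 2) ^ 4) →
        ¬ PermType (mergeA (fun j => (u j).support ∪ (v j).support) J j₀)) →
      (∀ (r : ℕ) (Jc : Fin r → Finset (Fin m)) (ac bc : Fin r → Fin m → Expo),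
        (∀ a ∈ tuples (fun j => (u j).support ∪ (v j).support), ∀ b ∈ tuples (fun j => (u j).support ∪ (v j).support),
          a ≠ b → ∑ j, a j = ∑ j, b j →
          ∃ k : Fin r, (∀ j, a j ≠ b j ↔ j ∈ Jc k) ∧
            ((∀ j ∈ Jc k, a j = ac k j ∧ b j = bc k j) ∨ (∀ j ∈ Jc k, a j = bc k j ∧ b j = ac k j))) →
        2 ^ m * (t + 2) ^ 4 < 2 * (m + 1) * (3 * (2 + m + m.choose 2) ^ 2) ^ r) →
      (¬ ∃ ρp ρm : Expo →₀ ℕ, RankOneCoincidences (fun j => (u j).support ∪ (v j).support) ρp ρm) →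
      ∀ (R : Expo → Expo → Prop) (S : Finset Expo), IsCellFamily u v R S → S.card ≤ 2 ^ (a * m) * (t + 2) ^ b) ↔
    (∃ a b : ℕ, ∀ (m t : ℕ), 2 ≤ t → ∀ (u v : Fin m → MvPolynomial (Fin 2) ℂ),
      (∀ j, coeff 0 (u j) = 0 ∧ (u j).support.card ≤ t) → (∀ j, coeff 0 (v j) = 0 ∧ (v j).support.card ≤ t) →
      ∀ (R : Expo → Expo → Prop) (S : Finset Expo),
        (∀ l ∈ S, ∃ ξ : Fin 2 → ℝ, ValidWeight u v ξ ∧ IsStrictTop ξ (logSupport u v) l ∧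
          ∀ e ∈ ((Finset.univ.biUnion fun j => (u j).support) ∪ Finset.univ.biUnion fun j => (v j).support),
          ∀ e' ∈ ((Finset.univ.biUnion fun j => (u j).support) ∪ Finset.univ.biUnion fun j => (v j).support),
            (R e e' ↔ wt ξ e ≤ wt ξ e')) →
        S.card ≤ 2 ^ (a * m) * (t + 2) ^ b) :=
  residualNoDatum_iff_residualV12.trans residualV12_iff_planarCellBound

end Summit.ValiantsHypothesis.Theorems.TwoProducts.Negative.FullPaddingResidual
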